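import Summits.QuantumFields.YangMills.Theorems.FluctuationComparisonRegPrIntLOrganTangentKnitV17
import Summits.QuantumFields.YangMills.Theorems.FluctuationComparisonRegPrIntLOrganTangentJensenGapKnit
import Summits.QuantumFields.YangMills.Theorems.FluctuationComparisonRegPrIntLOrganTangentAPackageFromHeight
import Summits.QuantumFields.YangMills.Theorems.FluctuationComparisonRegPrIntLOrganTangentFibreMeanToolsAnyCut
import Literature.MathematicalPhysics.QuantumFieldTheory.Balaban1983to89.T3MinimiserStabilityReduction
import HarnessLib

/-!
# Crux `FluctuationComparisonRegPrIntL` (stmt-QuantumFields-20520, rung R3), PATH-B organ O1 v17.2, LINE g25-1 «organ_tangent» v2.6, row JEN∘ `JensenGapCan` —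
# END TO END: **JEN∘ ⟸ JVAR∘ ALONE, FOR EVERY FAMILY** (the (A)-package is UNCONDITIONAL from a height, ✓`…OrganTangentAPackageFromHeight`; the Jensen gap is the
# integrated tilted fibre variance, ✓`…OrganTangentJensenGapKnit`; four-point combinations pass under the `t`-integral with the factor `1∕2`)

LEAD-20520 width seat ym-ust-20520-w3 g23 (cell ym3-torus), `--supports stmt-QuantumFields-20520` (helper).  THEOREMS ONLY, def-free; conclusion = tree
`Cruxes/FluctuationComparisonRegPrIntL/Lines/organ_tangent.lean` v2.6 (76720d4c) `JensenGapCan` BODY with the cutoff `sfCut θ U` inlined as the R-CUT-χ token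
`∏ p, max 0 (min 1 ((24∕25·θ − dist1(U(∂p)))∕((24∕25 − 1∕2)·θ)))` (the convention of ✓`…OrganTangentRegularE2EV26`).

THE LETTER JVAR∘ (`hJ`, displayed; LEAD's alternative one-letter cut of JEN∘ — the ideator's LINE g26-2 cuts instead into VAR∘ ∧ LME3∘; both are served by the
same kernel): JEN∘'s quantifier prefix VERBATIM (regime, class parameters, `κ₀`, `θ₀`, `C w₀ δ j₁`, the O1 v17.2 frame, the step `j` below the seed, ANY
disintegration `σ`, JEN∘'s window-continuous `m` with its a.e. identity), then FOR EVERY (A)-package `(σ₀, λ)` at `24∕25` (Markov, bind, fibre, finite, (A1),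
(A2), (A3) — the binder texts of ✓`…RegularE2EV26`'s `hA` at height `j`) and every presentation `(c, a, w)` of `h = log ρ_{j+1} − log ρ′_{j+1}` with
`x ≤ w₀`: `∃ W ≥ 0, Θ_j·W ≤ C·x² + δ_j ∧ ∀ t ∈ [0,1]`, every window four-point combination of
`V ↦ Var[h; ((χ·ρ′_{j+1})·λ_V).tilted (t·h)]` is `≤ W·e^{−κ·tdist}` — t-UNIFORM WINDOW CLUSTERING OF THE TILTED FIBRE VARIANCE (normalised by the tilt, hence
independent of the package's weight `c`).  ★`jensenGapCan_of_jvar : JVAR∘ → JEN∘`: `γ₁ := min γ₁ᴶ 1`, `j₁ := max j₁ᴶ jA(F,γ,b₀,p₀)` (✓(L8)), at each step the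
(A)-package from ✓(L8), the frame clauses ⑦ (cut step, `j + 1 ≤ Ts`) and ⑧ at `j, j+1` feed ✓`jensenGap_eq_integral_variance` (`q = ∫₀¹ (1−t)·Var_t dt` pointwise on
the window, continuity in `t`), JVAR∘ gives `W`, and `w′ := W∕2` by ✓`…JensenGapTools.abs_fourPoint_le_of_eq_integral`.

HONEST FRAMING: an implication over a hypothesis letter; JVAR∘ (the analytic heart: second-order clustering of the small-field fibre laws) is NOT proved;
JEN∘ is proved ONLY from JVAR∘; VAR∘∕LME3∘ (LINE g26-2), LIN∘ (under re-typing), O1, crux 20520, `YM3TorusSU2` are NOT proved; registry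
`Lines/semiclassical_s2beta.lean` v11.4 (★★OWNER RULING №36) untouched, nothing here is registered; rung R3 = SU(2) YM₃ on T³ — NOT d = 4, NOT infinite volume,
NOT a mass gap, NOT Clay; the Yang–Mills mass gap is NOT proved by any of this.
-/

set_option autoImplicit false

noncomputable section

namespace Summit.QuantumFields.YangMills.Theorems.OrganTangentJensenE2EV26

open MeasureTheory ProbabilityTheory Filter Topology Set
open scoped ENNReal
open Literature.MathematicalPhysics.QuantumFieldTheory.Balaban1983to89 T3ContinuumYM3Torus T3NestedUnitLaws
  T3UnitLawDensityEML T4Continuum BalabanUVClass T3UnitScaleTilt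
open Summit.QuantumFields.YangMills.Theorems.OrganTangentFibreMeanToolsAnyCut
  (continuous_sfCutRamp sfCutRamp_nonneg plaqSmall_of_sfCutRamp_ne_zero sfCutRamp_pos_of_plaqSmall half_lt_twentyFour_div_twentyFive_and_lt_one)
open Summit.QuantumFields.YangMills.Theorems.OrganTangentJensenGapKnit (jensenGap_eq_integral_variance)
open Summit.QuantumFields.YangMills.Theorems.OrganTangentJensenGapTools (abs_fourPoint_le_of_eq_integral)
open Summit.QuantumFields.YangMills.Theorems.FluctuationComparisonRegPrIntLOrganTangentAPackageFromHeight (exists_height_regularSmallFieldDisintegration)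

/-- ★ **JEN∘ (v2.6) ⟸ JVAR∘, EVERY FAMILY** — see the module docstring. [cite: Balaban1987RG1, §2 p.264 and Thm 1 (0.22)-(0.30) pp.256-258; Balaban1985Averaging, (10)-(13) p.19] -/
theorem jensenGapCan_of_jvar
    (hJ : ∃ γ₁ : ℝ, 0 < γ₁ ∧ ∀ (F : T3Family) (γ : ℝ), 0 < γ → γ ≤ γ₁ → ∀ (b₀ p₀ : ℝ) (j₀ : ℕ) (prm : ℕ → ClassParams) (η : ℕ → ℝ), 0 < b₀ → 0 < p₀ → AdmissibleClassParams F γ b₀ p₀ prm → (∀ j, 0 ≤ η j) → Summable η → Summable (fun i => ∑' k, η (k + i)) → Tendsto (fun j => (∑' k, η (k + j)) * ((1 + 2 * ((F.L : ℝ) ^ j / γ) * (Fintype.card (Plaq (F.P j) 0) : ℝ)) * (Fintype.card (PBond (F.P j) 0) : ℝ) ^ 2)) atTop (𝓝 0) → ∃ κ₀ : ℝ, 0 < κ₀ ∧ ∀ (κ : ℝ), 0 < κ → κ ≤ κ₀ → ∃ θ₀ : ℝ, 0 < θ₀ ∧ ∀ (θ : ℝ), 0 < θ → θ ≤ θ₀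 → ∃ (C w₀ : ℝ) (δ : ℕ → ℝ) (j₁ : ℕ), 0 ≤ C ∧ 0 < w₀ ∧ (∀ j, 0 ≤ δ j) ∧ Summable δ ∧ Summable (fun i => ∑' k, δ (k + i)) ∧ Tendsto (fun j => (∑' k, δ (k + j)) * ((1 + 2 * ((F.L : ℝ) ^ j / γ) * (Fintype.card (Plaq (F.P j) 0) : ℝ)) * (Fintype.card (PBond (F.P j) 0) : ℝ) ^ 2)) atTop (𝓝 0) ∧ j₀ ≤ j₁ ∧ ∀ (ν : ℕ → (j : ℕ) → MeasureTheory.Measure (GaugeField (F.P j) 0 ↥(Matrix.specialUnitaryGroup (Fin 2) ℂ))), (∀ K, ν K K = T4GenFunBounds.gibbsMeasure (F.P K) ((F.scheme ℰp γ).β K)) → (∀ K j, j < K → ν K j = Measure.map (descend F ℰp j) (ν K (j + 1))) → ∀ (K K' : ℕ), K ≤ K' → ∀ (Ts T : ℕ), Ts < T → T ≤ K → ∀ (μ μ' : ((j : ℕ) → MeasureTheory.Measure (GaugeField (F.P j) 0 ↥(Matrix.specialUnitaryGroup (Fin 2) ℂ)))) (ρ ρ' : ((j : ℕ) → GaugeField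 (F.P j) 0 ↥(Matrix.specialUnitaryGroup (Fin 2) ℂ) → ℝ)), (∀ j : ℕ, Ts ≤ j → j ≤ T → μ j = ν K j ∧ μ' j = ν K' j) → (∀ j : ℕ, j < Ts → μ j = Measure.map (descend F ℰp j) ((μ (j + 1)).withDensity (fun U => ENNReal.ofReal ((∏ p : Plaq (F.P (j + 1)) 0, max 0 (min 1 ((24 / 25 * θBal F.L γ b₀ p₀ (j + 1) - dist1 (GaugeField.plaqHol U p)) / ((24 / 25 - 1 / 2) * θBal F.L γ b₀ p₀ (j + 1)))))))) ∧ μ' j = Measure.map (descend F ℰp j) ((μ' (j + 1)).withDensity (fun U => ENNReal.ofReal ((∏ p : Plaq (F.P (j + 1)) 0, max 0 (min 1 ((24 / 25 * θBal F.L γ b₀ p₀ (j + 1) - dist1 (GaugeField.plaqHol U p)) / ((24 / 25 - 1 / 2) * θBal F.L γ b₀ p₀ (j + 1))))))))) → (∀ j : ℕ, Ts ≤ j → j < T → μ j = Measure.map (descend F ℰp j) (μ (j + 1)) ∧ μ' j = Measure.map (descend F ℰp j) (μ' (j + 1))) → (∀ j : ℕ, j ≤ T → IsFiniteMeasure (μ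 j) ∧ IsFiniteMeasure (μ' j)) → (∀ j : ℕ, j₀ ≤ j → j ≤ T → ((∀ U, PlaqSmall (θBal F.L γ b₀ p₀ j) U → 0 < ρ j U ∧ 0 < ρ' j U) ∧ μ j = (fieldMeasure _ _ _).withDensity (fun U => ENNReal.ofReal (ρ j U)) ∧ μ' j = (fieldMeasure _ _ _).withDensity (fun U => ENNReal.ofReal (ρ' j U)) ∧ (∃ κ : ℝ, MemAtHeight F ℰp j (prm j) (fun U => Real.exp κ * ρ j U)) ∧ (∃ κ : ℝ, MemAtHeight F ℰp j (prm j) (fun U => Real.exp κ * ρ' j U)) ∧ μ j {U | ¬ PlaqSmall (θBal F.L γ b₀ p₀ j) U} ≤ ENNReal.ofReal (η j) ∧ μ' j {U | ¬ PlaqSmall (θBal F.L γ b₀ p₀ j) U} ≤ ENNReal.ofReal (η j) ∧ (ContinuousOn (ρ j) {U | PlaqSmall (θBal F.L γ b₀ p₀ j) U} ∧ ContinuousOn (ρ' j) {U | PlaqSmall (θBal F.L γ b₀ p₀ j) U}))) → ∀ (j : ℕ), j₁ ≤ j → j + 2 ≤ T → j + 1 ≤ Ts → ∀ (σ : ProbabilityTheory.Kernel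 (GaugeField (F.P j) 0 ↥(Matrix.specialUnitaryGroup (Fin 2) ℂ)) (GaugeField (F.P (j + 1)) 0 ↥(Matrix.specialUnitaryGroup (Fin 2) ℂ))), ProbabilityTheory.IsMarkovKernel σ → (Measure.map (descend F ℰp j) (fieldMeasure (F.P (j + 1)) 0 ↥(Matrix.specialUnitaryGroup (Fin 2) ℂ))).bind ⇑σ = fieldMeasure (F.P (j + 1)) 0 ↥(Matrix.specialUnitaryGroup (Fin 2) ℂ) → (∀ᵐ V ∂(Measure.map (descend F ℰp j) (fieldMeasure (F.P (j + 1)) 0 ↥(Matrix.specialUnitaryGroup (Fin 2) ℂ))), ∀ᵐ U ∂(σ V), descend F ℰp j U = V) → ∀ (m : GaugeField (F.P j) 0 ↥(Matrix.specialUnitaryGroup (Fin 2) ℂ) → ℝ), ContinuousOn m {V | PlaqSmall (θBal F.L γ b₀ p₀ j) V} → (∀ᵐ V ∂(fieldMeasure (F.P j) 0 ↥(Matrix.specialUnitaryGroup (Fin 2) ℂ)), PlaqSmall (θBal F.L γ b₀ p₀ j) V → MeasureTheory.Integrable (fun U => (∏ p : Plaq (F.P (j + 1)) 0, max 0 (min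 1 ((24 / 25 * θBal F.L γ b₀ p₀ (j + 1) - dist1 (GaugeField.plaqHol U p)) / ((24 / 25 - 1 / 2) * θBal F.L γ b₀ p₀ (j + 1))))) * (Real.log (ρ (j + 1) U) - Real.log (ρ' (j + 1) U)) * ρ' (j + 1) U) (σ V) ∧ m V = (∫ U, (∏ p : Plaq (F.P (j + 1)) 0, max 0 (min 1 ((24 / 25 * θBal F.L γ b₀ p₀ (j + 1) - dist1 (GaugeField.plaqHol U p)) / ((24 / 25 - 1 / 2) * θBal F.L γ b₀ p₀ (j + 1))))) * (Real.log (ρ (j + 1) U) - Real.log (ρ' (j + 1) U)) * ρ' (j + 1) U ∂(σ V)) / (∫ U, (∏ p : Plaq (F.P (j + 1)) 0, max 0 (min 1 ((24 / 25 * θBal F.L γ b₀ p₀ (j + 1) - dist1 (GaugeField.plaqHol U p)) / ((24 / 25 - 1 / 2) * θBal F.L γ b₀ p₀ (j + 1))))) * ρ' (j + 1) U ∂(σ V))) → ∀ (σ₀ : ProbabilityTheory.Kernel (GaugeField (F.P j) 0 ↥(Matrix.specialUnitaryGroup (Fin 2) ℂ)) (GaugeField (F.P (j + 1)) 0 ↥(Matrix.specialUnitaryGroup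 (Fin 2) ℂ))) (lam : GaugeField (F.P j) 0 ↥(Matrix.specialUnitaryGroup (Fin 2) ℂ) → MeasureTheory.Measure (GaugeField (F.P (j + 1)) 0 ↥(Matrix.specialUnitaryGroup (Fin 2) ℂ))), ProbabilityTheory.IsMarkovKernel σ₀ → (Measure.map (descend F ℰp j) (fieldMeasure (F.P (j + 1)) 0 ↥(Matrix.specialUnitaryGroup (Fin 2) ℂ))).bind ⇑σ₀ = fieldMeasure (F.P (j + 1)) 0 ↥(Matrix.specialUnitaryGroup (Fin 2) ℂ) → (∀ᵐ V ∂(Measure.map (descend F ℰp j) (fieldMeasure (F.P (j + 1)) 0 ↥(Matrix.specialUnitaryGroup (Fin 2) ℂ))), ∀ᵐ U ∂(σ₀ V), descend F ℰp j U = V) → (∀ V, MeasureTheory.IsFiniteMeasure (lam V)) → (∀ f : GaugeField (F.P (j + 1)) 0 ↥(Matrix.specialUnitaryGroup (Fin 2) ℂ) → ℝ, Continuous f → (∀ U, f U ≠ 0 → PlaqSmall (24 / 25 * θBal F.L γ b₀ p₀ (j + 1)) U) → ContinuousOn (fun V => ∫ U, f U ∂(lam V)) {V | PlaqSmall (θBal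 F.L γ b₀ p₀ j) V}) → (∀ V, PlaqSmall (θBal F.L γ b₀ p₀ j) V → 0 < lam V {U | PlaqSmall (24 / 25 * θBal F.L γ b₀ p₀ (j + 1)) U}) → (∃ c : GaugeField (F.P j) 0 ↥(Matrix.specialUnitaryGroup (Fin 2) ℂ) → ℝ, ∀ f : GaugeField (F.P (j + 1)) 0 ↥(Matrix.specialUnitaryGroup (Fin 2) ℂ) → ℝ, Continuous f → (∀ U, ¬ PlaqSmall (24 / 25 * θBal F.L γ b₀ p₀ (j + 1)) U → f U = 0) → ∀ᵐ V ∂(Measure.map (descend F ℰp j) (fieldMeasure (F.P (j + 1)) 0 ↥(Matrix.specialUnitaryGroup (Fin 2) ℂ))), PlaqSmall (θBal F.L γ b₀ p₀ j) V → 0 < c V ∧ ∫ U, f U ∂(σ₀ V) = c V * ∫ U, f U ∂(lam V)) → ∀ (c : Plaq (F.P (j + 1)) 0 → ℝ) (a w : ℝ), 0 ≤ a → 0 ≤ w → a + θ / (((F.L : ℝ) ^ (j + 1) / γ) * θBal F.L γ b₀ p₀ (j + 1) ^ 2) * w ≤ w₀ → ((∀ p, |c p| ≤ a) ∧ (∀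 (b b' : PBond (F.P (j + 1)) 0) U V W Z, PlaqSmall (θBal F.L γ b₀ p₀ (j + 1)) U → PlaqSmall (θBal F.L γ b₀ p₀ (j + 1)) V → PlaqSmall (θBal F.L γ b₀ p₀ (j + 1)) W → PlaqSmall (θBal F.L γ b₀ p₀ (j + 1)) Z → (∀ e, e ≠ b → U e = V e) → (∀ e, e ≠ b' → U e = W e) → (∀ e, e ≠ b' → V e = Z e) → (∀ e, e ≠ b → W e = Z e) → |(Real.log (ρ (j + 1) U) - Real.log (ρ' (j + 1) U) - ((F.L : ℝ) ^ (j + 1) / γ) * ∑ p, c p * (1 - reTr (GaugeField.plaqHol U p))) - (Real.log (ρ (j + 1) V) - Real.log (ρ' (j + 1) V) - ((F.L : ℝ) ^ (j + 1) / γ) * ∑ p, c p * (1 - reTr (GaugeField.plaqHol V p))) - ((Real.log (ρ (j + 1) W) - Real.log (ρ' (j + 1) W) - ((F.L : ℝ) ^ (j + 1) / γ) * ∑ p, c p * (1 - reTr (GaugeField.plaqHol W p))) - (Real.log (ρ (j + 1) Z) - Real.log (ρ' (j + 1) Z) - ((F.L : ℝ) ^ (j + 1) / γ) * ∑ p, c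 p * (1 - reTr (GaugeField.plaqHol Z p))))| ≤ w * Real.exp (-(κ * (b.src.tdist b'.src : ℝ))))) → ∃ (Wv : ℝ), 0 ≤ Wv ∧ θ / (((F.L : ℝ) ^ j / γ) * θBal F.L γ b₀ p₀ j ^ 2) * Wv ≤ C * (a + θ / (((F.L : ℝ) ^ (j + 1) / γ) * θBal F.L γ b₀ p₀ (j + 1) ^ 2) * w) * (a + θ / (((F.L : ℝ) ^ (j + 1) / γ) * θBal F.L γ b₀ p₀ (j + 1) ^ 2) * w) + δ j ∧ ∀ t ∈ Set.Icc (0 : ℝ) 1, (∀ (b b' : PBond (F.P j) 0) U V W Z, PlaqSmall (θBal F.L γ b₀ p₀ j) U → PlaqSmall (θBal F.L γ b₀ p₀ j) V → PlaqSmall (θBal F.L γ b₀ p₀ j) W → PlaqSmall (θBal F.L γ b₀ p₀ j) Z → (∀ e, e ≠ b → U e = V e) → (∀ e, e ≠ b' → U e = W e) → (∀ e, e ≠ b' → V e = Z e) → (∀ e, e ≠ b → W e = Z e) → |ProbabilityTheory.variance (fun Y => Real.log (ρ (j + 1) Y) - Real.log (ρ' (j + 1) Y)) (((lam U).withDensity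 (fun Y => ENNReal.ofReal ((∏ p : Plaq (F.P (j + 1)) 0, max 0 (min 1 ((24 / 25 * θBal F.L γ b₀ p₀ (j + 1) - dist1 (GaugeField.plaqHol Y p)) / ((24 / 25 - 1 / 2) * θBal F.L γ b₀ p₀ (j + 1))))) * ρ' (j + 1) Y))).tilted (fun Y => t * (Real.log (ρ (j + 1) Y) - Real.log (ρ' (j + 1) Y)))) - ProbabilityTheory.variance (fun Y => Real.log (ρ (j + 1) Y) - Real.log (ρ' (j + 1) Y)) (((lam V).withDensity (fun Y => ENNReal.ofReal ((∏ p : Plaq (F.P (j + 1)) 0, max 0 (min 1 ((24 / 25 * θBal F.L γ b₀ p₀ (j + 1) - dist1 (GaugeField.plaqHol Y p)) / ((24 / 25 - 1 / 2) * θBal F.L γ b₀ p₀ (j + 1))))) * ρ' (j + 1) Y))).tilted (fun Y => t * (Real.log (ρ (j + 1) Y) - Real.log (ρ' (j + 1) Y)))) - (ProbabilityTheory.variance (fun Y => Real.log (ρ (j + 1) Y) - Real.log (ρ' (j + 1) Y)) (((lam W).withDensity (fun Y => ENNReal.ofReal ((∏ p : Plaq (F.P (j + 1)) 0, max 0 (min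 1 ((24 / 25 * θBal F.L γ b₀ p₀ (j + 1) - dist1 (GaugeField.plaqHol Y p)) / ((24 / 25 - 1 / 2) * θBal F.L γ b₀ p₀ (j + 1))))) * ρ' (j + 1) Y))).tilted (fun Y => t * (Real.log (ρ (j + 1) Y) - Real.log (ρ' (j + 1) Y)))) - ProbabilityTheory.variance (fun Y => Real.log (ρ (j + 1) Y) - Real.log (ρ' (j + 1) Y)) (((lam Z).withDensity (fun Y => ENNReal.ofReal ((∏ p : Plaq (F.P (j + 1)) 0, max 0 (min 1 ((24 / 25 * θBal F.L γ b₀ p₀ (j + 1) - dist1 (GaugeField.plaqHol Y p)) / ((24 / 25 - 1 / 2) * θBal F.L γ b₀ p₀ (j + 1))))) * ρ' (j + 1) Y))).tilted (fun Y => t * (Real.log (ρ (j + 1) Y) - Real.log (ρ' (j + 1) Y)))))| ≤ Wv * Real.exp (-(κ * (b.src.tdist b'.src : ℝ))))) :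
    ∃ γ₁ : ℝ, 0 < γ₁ ∧ ∀ (F : T3Family) (γ : ℝ), 0 < γ → γ ≤ γ₁ → ∀ (b₀ p₀ : ℝ) (j₀ : ℕ) (prm : ℕ → ClassParams) (η : ℕ → ℝ), 0 < b₀ → 0 < p₀ → AdmissibleClassParams F γ b₀ p₀ prm → (∀ j, 0 ≤ η j) → Summable η → Summable (fun i => ∑' k, η (k + i)) → Tendsto (fun j => (∑' k, η (k + j)) * ((1 + 2 * ((F.L : ℝ) ^ j / γ) * (Fintype.card (Plaq (F.P j) 0) : ℝ)) * (Fintype.card (PBond (F.P j) 0) : ℝ) ^ 2)) atTop (𝓝 0) → ∃ κ₀ : ℝ, 0 < κ₀ ∧ ∀ (κ : ℝ), 0 < κ → κ ≤ κ₀ → ∃ θ₀ : ℝ, 0 < θ₀ ∧ ∀ (θ : ℝ), 0 < θ → θ ≤ θ₀ → ∃ (C w₀ : ℝ) (δ : ℕ → ℝ) (j₁ : ℕ), 0 ≤ C ∧ 0 < w₀ ∧ (∀ j, 0 ≤ δ j) ∧ Summable δ ∧ Summable (fun i => ∑' k, δ (k + i)) ∧ Tendsto (fun j => (∑' k, δ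 (k + j)) * ((1 + 2 * ((F.L : ℝ) ^ j / γ) * (Fintype.card (Plaq (F.P j) 0) : ℝ)) * (Fintype.card (PBond (F.P j) 0) : ℝ) ^ 2)) atTop (𝓝 0) ∧ j₀ ≤ j₁ ∧ ∀ (ν : ℕ → (j : ℕ) → MeasureTheory.Measure (GaugeField (F.P j) 0 ↥(Matrix.specialUnitaryGroup (Fin 2) ℂ))), (∀ K, ν K K = T4GenFunBounds.gibbsMeasure (F.P K) ((F.scheme ℰp γ).β K)) → (∀ K j, j < K → ν K j = Measure.map (descend F ℰp j) (ν K (j + 1))) → ∀ (K K' : ℕ), K ≤ K' → ∀ (Ts T : ℕ), Ts < T → T ≤ K → ∀ (μ μ' : ((j : ℕ) → MeasureTheory.Measure (GaugeField (F.P j) 0 ↥(Matrix.specialUnitaryGroup (Fin 2) ℂ)))) (ρ ρ' : ((j : ℕ) → GaugeField (F.P j) 0 ↥(Matrix.specialUnitaryGroup (Fin 2) ℂ) → ℝ)), (∀ j : ℕ, Ts ≤ j → j ≤ T → μ j = ν K j ∧ μ' j = ν K' j) → (∀ j : ℕ, j < Ts → μ j = Measure.map (descend F ℰp j) ((μ (j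 + 1)).withDensity (fun U => ENNReal.ofReal ((∏ p : Plaq (F.P (j + 1)) 0, max 0 (min 1 ((24 / 25 * θBal F.L γ b₀ p₀ (j + 1) - dist1 (GaugeField.plaqHol U p)) / ((24 / 25 - 1 / 2) * θBal F.L γ b₀ p₀ (j + 1)))))))) ∧ μ' j = Measure.map (descend F ℰp j) ((μ' (j + 1)).withDensity (fun U => ENNReal.ofReal ((∏ p : Plaq (F.P (j + 1)) 0, max 0 (min 1 ((24 / 25 * θBal F.L γ b₀ p₀ (j + 1) - dist1 (GaugeField.plaqHol U p)) / ((24 / 25 - 1 / 2) * θBal F.L γ b₀ p₀ (j + 1))))))))) → (∀ j : ℕ, Ts ≤ j → j < T → μ j = Measure.map (descend F ℰp j) (μ (j + 1)) ∧ μ' j = Measure.map (descend F ℰp j) (μ' (j + 1))) → (∀ j : ℕ, j ≤ T → IsFiniteMeasure (μ j) ∧ IsFiniteMeasure (μ' j)) → (∀ j : ℕ, j₀ ≤ j → j ≤ T → ((∀ U, PlaqSmall (θBal F.L γ b₀ p₀ j) U → 0 < ρ j U ∧ 0 < ρ' j U) ∧ μ j = (fieldMeasure _ _ _).withDensity (fun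 U => ENNReal.ofReal (ρ j U)) ∧ μ' j = (fieldMeasure _ _ _).withDensity (fun U => ENNReal.ofReal (ρ' j U)) ∧ (∃ κ : ℝ, MemAtHeight F ℰp j (prm j) (fun U => Real.exp κ * ρ j U)) ∧ (∃ κ : ℝ, MemAtHeight F ℰp j (prm j) (fun U => Real.exp κ * ρ' j U)) ∧ μ j {U | ¬ PlaqSmall (θBal F.L γ b₀ p₀ j) U} ≤ ENNReal.ofReal (η j) ∧ μ' j {U | ¬ PlaqSmall (θBal F.L γ b₀ p₀ j) U} ≤ ENNReal.ofReal (η j) ∧ (ContinuousOn (ρ j) {U | PlaqSmall (θBal F.L γ b₀ p₀ j) U} ∧ ContinuousOn (ρ' j) {U | PlaqSmall (θBal F.L γ b₀ p₀ j) U}))) → ∀ (j : ℕ), j₁ ≤ j → j + 2 ≤ T → j + 1 ≤ Ts → ∀ (σ : ProbabilityTheory.Kernel (GaugeField (F.P j) 0 ↥(Matrix.specialUnitaryGroup (Fin 2) ℂ)) (GaugeField (F.P (j + 1)) 0 ↥(Matrix.specialUnitaryGroup (Fin 2) ℂ))), ProbabilityTheory.IsMarkovKernel σ → (Measure.map (descend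 F ℰp j) (fieldMeasure (F.P (j + 1)) 0 ↥(Matrix.specialUnitaryGroup (Fin 2) ℂ))).bind ⇑σ = fieldMeasure (F.P (j + 1)) 0 ↥(Matrix.specialUnitaryGroup (Fin 2) ℂ) → (∀ᵐ V ∂(Measure.map (descend F ℰp j) (fieldMeasure (F.P (j + 1)) 0 ↥(Matrix.specialUnitaryGroup (Fin 2) ℂ))), ∀ᵐ U ∂(σ V), descend F ℰp j U = V) → ∀ (m : GaugeField (F.P j) 0 ↥(Matrix.specialUnitaryGroup (Fin 2) ℂ) → ℝ), ContinuousOn m {V | PlaqSmall (θBal F.L γ b₀ p₀ j) V} → (∀ᵐ V ∂(fieldMeasure (F.P j) 0 ↥(Matrix.specialUnitaryGroup (Fin 2) ℂ)), PlaqSmall (θBal F.L γ b₀ p₀ j) V → MeasureTheory.Integrable (fun U => (∏ p : Plaq (F.P (j + 1)) 0, max 0 (min 1 ((24 / 25 * θBal F.L γ b₀ p₀ (j + 1) - dist1 (GaugeField.plaqHol U p)) / ((24 / 25 - 1 / 2) * θBal F.L γ b₀ p₀ (j + 1))))) * (Real.log (ρ (j + 1) U) - Real.log (ρ' (j + 1)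 U)) * ρ' (j + 1) U) (σ V) ∧ m V = (∫ U, (∏ p : Plaq (F.P (j + 1)) 0, max 0 (min 1 ((24 / 25 * θBal F.L γ b₀ p₀ (j + 1) - dist1 (GaugeField.plaqHol U p)) / ((24 / 25 - 1 / 2) * θBal F.L γ b₀ p₀ (j + 1))))) * (Real.log (ρ (j + 1) U) - Real.log (ρ' (j + 1) U)) * ρ' (j + 1) U ∂(σ V)) / (∫ U, (∏ p : Plaq (F.P (j + 1)) 0, max 0 (min 1 ((24 / 25 * θBal F.L γ b₀ p₀ (j + 1) - dist1 (GaugeField.plaqHol U p)) / ((24 / 25 - 1 / 2) * θBal F.L γ b₀ p₀ (j + 1))))) * ρ' (j + 1) U ∂(σ V))) → ∀ (c : Plaq (F.P (j + 1)) 0 → ℝ) (a w : ℝ), 0 ≤ a → 0 ≤ w → a + θ / (((F.L : ℝ) ^ (j + 1) / γ) * θBal F.L γ b₀ p₀ (j + 1) ^ 2) * w ≤ w₀ → ((∀ p, |c p| ≤ a) ∧ (∀ (b b' : PBond (F.P (j + 1)) 0) U V W Z, PlaqSmall (θBal F.L γ b₀ p₀ (j + 1)) U → PlaqSmall (θBal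 F.L γ b₀ p₀ (j + 1)) V → PlaqSmall (θBal F.L γ b₀ p₀ (j + 1)) W → PlaqSmall (θBal F.L γ b₀ p₀ (j + 1)) Z → (∀ e, e ≠ b → U e = V e) → (∀ e, e ≠ b' → U e = W e) → (∀ e, e ≠ b' → V e = Z e) → (∀ e, e ≠ b → W e = Z e) → |(Real.log (ρ (j + 1) U) - Real.log (ρ' (j + 1) U) - ((F.L : ℝ) ^ (j + 1) / γ) * ∑ p, c p * (1 - reTr (GaugeField.plaqHol U p))) - (Real.log (ρ (j + 1) V) - Real.log (ρ' (j + 1) V) - ((F.L : ℝ) ^ (j + 1) / γ) * ∑ p, c p * (1 - reTr (GaugeField.plaqHol V p))) - ((Real.log (ρ (j + 1) W) - Real.log (ρ' (j + 1) W) - ((F.L : ℝ) ^ (j + 1) / γ) * ∑ p, c p * (1 - reTr (GaugeField.plaqHol W p))) - (Real.log (ρ (j + 1) Z) - Real.log (ρ' (j + 1) Z) - ((F.L : ℝ) ^ (j + 1) / γ) * ∑ p, c p * (1 - reTr (GaugeField.plaqHol Z p))))| ≤ w * Real.exp (-(κ * (b.src.tdist b'.src : ℝ))))) → ∃ (w'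 : ℝ), 0 ≤ w' ∧ θ / (((F.L : ℝ) ^ j / γ) * θBal F.L γ b₀ p₀ j ^ 2) * w' ≤ C * (a + θ / (((F.L : ℝ) ^ (j + 1) / γ) * θBal F.L γ b₀ p₀ (j + 1) ^ 2) * w) * (a + θ / (((F.L : ℝ) ^ (j + 1) / γ) * θBal F.L γ b₀ p₀ (j + 1) ^ 2) * w) + δ j ∧ (∀ (b b' : PBond (F.P j) 0) U V W Z, PlaqSmall (θBal F.L γ b₀ p₀ j) U → PlaqSmall (θBal F.L γ b₀ p₀ j) V → PlaqSmall (θBal F.L γ b₀ p₀ j) W → PlaqSmall (θBal F.L γ b₀ p₀ j) Z → (∀ e, e ≠ b → U e = V e) → (∀ e, e ≠ b' → U e = W e) → (∀ e, e ≠ b' → V e = Z e) → (∀ e, e ≠ b → W e = Z e) → |(Real.log (ρ j U) - Real.log (ρ' j U) - m U) - (Real.log (ρ j V) - Real.log (ρ' j V) - m V) - ((Real.log (ρ j W) - Real.log (ρ' j W) - m W) - (Real.log (ρ j Z) - Real.log (ρ' j Z) - m Z))| ≤ w' * Real.exp (-(κ * (b.src.tdist b'.src : ℝ)))) := by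
  obtain ⟨γ₁, hγ₁, hJ⟩ := hJ
  refine ⟨min γ₁ 1, lt_min hγ₁ one_pos, ?_⟩
  intro F γ hγ hγle b₀ p₀ j₀ prm η hb₀ hp₀ hadm hη0 hηs hηss hηt
  have hγ1 : γ ≤ 1 := hγle.trans (min_le_right _ _)
  obtain ⟨κ₀, hκ₀, hJ⟩ := hJ F γ hγ (hγle.trans (min_le_left _ _)) b₀ p₀ j₀ prm η hb₀ hp₀ hadm hη0 hηs hηss hηt
  refine ⟨κ₀, hκ₀, ?_⟩
  intro κ hκ hκle
  obtain ⟨θ₀, hθ₀, hJ⟩ := hJ κ hκ hκle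
  refine ⟨θ₀, hθ₀, ?_⟩
  intro θ hθpos hθle
  obtain ⟨C, w₀, δ, j₁, hC, hw₀, hδ0, hδs, hδss, hδt, hj₀₁, hJ⟩ := hJ θ hθpos hθle
  obtain ⟨jA, hjA⟩ := exists_height_regularSmallFieldDisintegration F γ b₀ p₀ hγ hγ1 hb₀ hp₀
  refine ⟨C, w₀, δ, max j₁ jA, hC, hw₀, hδ0, hδs, hδss, hδt, hj₀₁.trans (le_max_left _ _), ?_⟩
  intro ν hνK hνc K K' hKK' Ts T hTsT hTK μ μ' ρ ρ' hanch hcut huncut hfin hwin j hj₁ hjT hjTs σ hσM hbind hfib m hmc hm c a w ha hw hx hpres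
  have hj₁' : j₁ ≤ j := (le_max_left _ _).trans hj₁
  have hjA' : jA ≤ j := (le_max_right _ _).trans hj₁
  obtain ⟨σ₀, lam, hσ₀M, hbind₀, hfib₀, hlam, hA1, hA2, hA3⟩ := hjA j hjA'
  -- JVAR∘ at this data
  obtain ⟨Wv, hWv0, hWvb, h4⟩ := hJ ν hνK hνc K K' hKK' Ts T hTsT hTK μ μ' ρ ρ' hanch hcut huncut hfin hwin j hj₁' hjT hjTs σ hσM
    hbind hfib m hmc hm σ₀ lam hσ₀M hbind₀ hfib₀ hlam hA1 hA2 hA3 c a w ha hw hx hpres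
  -- the frame at heights `j, j+1`
  have hθ' : 0 < θBal F.L γ b₀ p₀ (j + 1) := T3MinimiserStabilityReduction.θBal_pos F.hL.2.le hγ hγ1 hb₀ p₀ (j + 1)
  have hc12 : (1 / 2 : ℝ) < 24 / 25 := half_lt_twentyFour_div_twentyFive_and_lt_one.1
  have hcW : (24 / 25 : ℝ) < 1 := half_lt_twentyFour_div_twentyFive_and_lt_one.2
  have hw1 := hwin (j + 1) (by omega) (by omega)
  have hw0 := hwin j (by omega) (by omega)
  -- measurability from membership modulo constants (R-n4), four times
  have hmeas : ∀ (g : GaugeField (F.P (j + 1)) 0 ↥(Matrix.specialUnitaryGroup (Fin 2) ℂ) → ℝ),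
      (∃ κ' : ℝ, MemAtHeight F ℰp (j + 1) (prm (j + 1)) (fun U => Real.exp κ' * g U)) → Measurable g := by
    intro g ⟨κ', hκ'⟩
    have h1 : Measurable (fun U => Real.exp κ' * g U) := hκ'.measurable
    have h2 : g = fun U => (Real.exp κ')⁻¹ * (Real.exp κ' * g U) := by
      funext U; rw [← mul_assoc, inv_mul_cancel₀ (Real.exp_pos κ').ne', one_mul]
    rw [h2]; exact h1.const_mul _
  have hmeas0 : ∀ (g : GaugeField (F.P j) 0 ↥(Matrix.specialUnitaryGroup (Fin 2) ℂ) → ℝ),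
      (∃ κ' : ℝ, MemAtHeight F ℰp j (prm j) (fun U => Real.exp κ' * g U)) → Measurable g := by
    intro g ⟨κ', hκ'⟩
    have h1 : Measurable (fun U => Real.exp κ' * g U) := hκ'.measurable
    have h2 : g = fun U => (Real.exp κ')⁻¹ * (Real.exp κ' * g U) := by
      funext U; rw [← mul_assoc, inv_mul_cancel₀ (Real.exp_pos κ').ne', one_mul]
    rw [h2]; exact h1.const_mul _
  have hρ1m : Measurable (ρ (j + 1)) := hmeas _ hw1.2.2.2.1
  have hρ1m' : Measurable (ρ' (j + 1)) := hmeas _ hw1.2.2.2.2.1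
  have hρ0m : Measurable (ρ j) := hmeas0 _ hw0.2.2.2.1
  have hρ0m' : Measurable (ρ' j) := hmeas0 _ hw0.2.2.2.2.1
  -- the SF-projected consistency identities (CUT step: `j < Ts`)
  have hjlt : j < Ts := by omega
  have hcons : (((fieldMeasure (F.P (j + 1)) 0 ↥(Matrix.specialUnitaryGroup (Fin 2) ℂ)).withDensity
        (fun U => ENNReal.ofReal (ρ (j + 1) U))).withDensity (fun U => ENNReal.ofReal ((∏ p : Plaq (F.P (j + 1)) 0, max 0 (min 1 ((24 / 25 * θBal F.L γ b₀ p₀ (j + 1) - dist1 (GaugeField.plaqHol U p)) / ((24 / 25 - 1 / 2) * θBal F.L γ b₀ p₀ (j + 1)))))))).map (descend F ℰp j) =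
      (fieldMeasure (F.P j) 0 ↥(Matrix.specialUnitaryGroup (Fin 2) ℂ)).withDensity (fun V => ENNReal.ofReal (ρ j V)) := by
    rw [← hw1.2.1, ← (hcut j hjlt).1, hw0.2.1]
  have hcons' : (((fieldMeasure (F.P (j + 1)) 0 ↥(Matrix.specialUnitaryGroup (Fin 2) ℂ)).withDensity
        (fun U => ENNReal.ofReal (ρ' (j + 1) U))).withDensity (fun U => ENNReal.ofReal ((∏ p : Plaq (F.P (j + 1)) 0, max 0 (min 1 ((24 / 25 * θBal F.L γ b₀ p₀ (j + 1) - dist1 (GaugeField.plaqHol U p)) / ((24 / 25 - 1 / 2) * θBal F.L γ b₀ p₀ (j + 1)))))))).map (descend F ℰp j) =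
      (fieldMeasure (F.P j) 0 ↥(Matrix.specialUnitaryGroup (Fin 2) ℂ)).withDensity (fun V => ENNReal.ofReal (ρ' j V)) := by
    rw [← hw1.2.2.1, ← (hcut j hjlt).2, hw0.2.2.1]
  -- the knit: `q = ∫₀¹ (1−t)·Var_t dt` on the window, continuity in `t`
  have hq := jensenGap_eq_integral_variance F γ b₀ p₀ j hθ' (24 / 25) hcW (ρ (j + 1)) (ρ' (j + 1)) hρ1m hρ1m' (ρ j) (ρ' j) hρ0m hρ0m'
    hw1.1 hw1.2.2.2.2.2.2.2.1 hw1.2.2.2.2.2.2.2.2 (fun V hV => hw0.1 V hV) hw0.2.2.2.2.2.2.2.1 hw0.2.2.2.2.2.2.2.2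
    (fun U => (∏ p : Plaq (F.P (j + 1)) 0, max 0 (min 1 ((24 / 25 * θBal F.L γ b₀ p₀ (j + 1) - dist1 (GaugeField.plaqHol U p)) / ((24 / 25 - 1 / 2) * θBal F.L γ b₀ p₀ (j + 1)))))) (continuous_sfCutRamp _ _ _) (sfCutRamp_nonneg _ _ _)
    (plaqSmall_of_sfCutRamp_ne_zero hc12 hθ') (sfCutRamp_pos_of_plaqSmall hc12 hθ')
    hcons hcons' σ hσM hbind hfib m hmc hm σ₀ hσ₀M hbind₀ hfib₀ lam hlam hA1 hA2 hA3
  -- the marginal-unit weight is non-negative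
  have hΘ : 0 ≤ θ / (((F.L : ℝ) ^ j / γ) * θBal F.L γ b₀ p₀ j ^ 2) := by
    have hL : (0 : ℝ) < F.L := by exact_mod_cast (show 0 < F.L by have := F.hL.2; omega)
    positivity
  refine ⟨Wv / 2, by linarith, ?_, ?_⟩
  · have h1 : θ / (((F.L : ℝ) ^ j / γ) * θBal F.L γ b₀ p₀ j ^ 2) * (Wv / 2) ≤
        θ / (((F.L : ℝ) ^ j / γ) * θBal F.L γ b₀ p₀ j ^ 2) * Wv := by
      have := mul_nonneg hΘ hWv0; nlinarith
    exact h1.trans hWvb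
  · intro b b' U V W Z hU hV hW hZ e1 e2 e3 e4
    exact abs_fourPoint_le_of_eq_integral (S := {X | PlaqSmall (θBal F.L γ b₀ p₀ j) X})
      (q := fun X => Real.log (ρ j X) - Real.log (ρ' j X) - m X)
      (A := fun X t => ProbabilityTheory.variance (fun Y => Real.log (ρ (j + 1) Y) - Real.log (ρ' (j + 1) Y))
        (((lam X).withDensity (fun Y => ENNReal.ofReal ((∏ p : Plaq (F.P (j + 1)) 0, max 0 (min 1 ((24 / 25 * θBal F.L γ b₀ p₀ (j + 1) - dist1 (GaugeField.plaqHol Y p)) / ((24 / 25 - 1 / 2) * θBal F.L γ b₀ p₀ (j + 1))))) * ρ' (j + 1) Y))).tilted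
          (fun Y => t * (Real.log (ρ (j + 1) Y) - Real.log (ρ' (j + 1) Y)))))
      hq hU hV hW hZ (fun t ht => h4 t ht b b' U V W Z hU hV hW hZ e1 e2 e3 e4)

end Summit.QuantumFields.YangMills.Theorems.OrganTangentJensenE2EV26

end
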